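import Summits.FinalStateConjecture.FinalStateConjecture.Theorems.PhotonSphereChannelsExteriorEnergy
import Summits.FinalStateConjecture.FinalStateConjecture.Theorems.PhotonSphereChannelsBlindnessWaveTransfer

/-!
# Crux `UniformPhotonSphereChannels` (K1), negative side — the conformal (null-separable) chain rule

Support file of the standing disprover of item stmt-FinalStateConjecture-10045 (Rindler frame).
For `Ψ ∈ C²(ℝ²)` (variables `(t, x)`) and `p, q ∈ C²(ℝ)`, the null-separable change of
variables `t = (p(X+T) − q(X−T))/2`, `x = (p(X+T) + q(X−T))/2` — `x ± t` is a function of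
`X ± T` alone — transforms the `1+1` wave operator conformally:

`u_TT − u_XX = (Ψ_tt − Ψ_xx)∘S · p′(X+T) q′(X−T)`,   `u = Ψ ∘ S`

(`wave_conformal`), with the first partials `u_T = DΨ(S)(σ, δ)`, `u_X = DΨ(S)(δ, σ)`,
`σ = (p′+q′)/2`, `δ = (p′−q′)/2` (`fderiv_conformal_fst/snd`).  With `p = q = κ⁻¹ log(κ ·)`
this is the near-horizon Minkowski (Rindler/Kruskal) frame of the tortoise line; the lemma is
stated for general `p, q` so that a globally smooth modification of the logarithm can be used.
Slice computation: `(Ψ∘γ)″ = D²Ψ(γ′, γ′) + DΨ(γ″)` and the `γ″` terms of the two slices agree.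
[folklore]
-/

namespace Summit.FinalStateConjecture.FinalStateConjecture.Theorems

open Set Filter Topology

noncomputable section

namespace WaveDefect

open WaveEnergy Blindness

variable {Ψ : ℝ × ℝ → ℝ} {p q : ℝ → ℝ}

/-- Second derivative of `Ψ` along a `C²` curve: `(Ψ ∘ γ)″(τ) = D²Ψ(γ τ)(γ′ τ)(γ′ τ) + DΨ(γ τ)(γ″ τ)`. -/
theorem iteratedDeriv_two_comp_curve (hΨ : ContDiff ℝ 2 Ψ) {γ γ' : ℝ → ℝ × ℝ} {γ'' : ℝ × ℝ}
    (hγ : ∀ τ, HasDerivAt γ (γ' τ) τ) {τ₀ : ℝ} (hγ' : HasDerivAt γ' γ'' τ₀) :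
    iteratedDeriv 2 (fun τ => Ψ (γ τ)) τ₀
      = fderiv ℝ (fderiv ℝ Ψ) (γ τ₀) (γ' τ₀) (γ' τ₀) + fderiv ℝ Ψ (γ τ₀) γ'' := by
  have hd := differentiable_of_contDiff_two hΨ
  have hd2 := differentiable_fderiv_of_contDiff_two hΨ
  have h1 : ∀ τ, HasDerivAt (fun τ => Ψ (γ τ)) (fderiv ℝ Ψ (γ τ) (γ' τ)) τ := fun τ =>
    hasDerivAt_comp_curve hd (hγ τ)
  have hL : HasDerivAt (fun τ => fderiv ℝ Ψ (γ τ)) (fderiv ℝ (fderiv ℝ Ψ) (γ τ₀) (γ' τ₀)) τ₀ :=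
    (hd2 (γ τ₀)).hasFDerivAt.comp_hasDerivAt τ₀ (hγ τ₀)
  have h2 : HasDerivAt (fun τ => fderiv ℝ Ψ (γ τ) (γ' τ))
      (fderiv ℝ (fderiv ℝ Ψ) (γ τ₀) (γ' τ₀) (γ' τ₀) + fderiv ℝ Ψ (γ τ₀) γ'') τ₀ :=
    hL.clm_apply hγ'
  exact iteratedDeriv_two_eq_of_hasDerivAt h1 h2

/-- Bilinear algebra: for a symmetric `D`, `D(σ,δ)(σ,δ) − D(δ,σ)(δ,σ) = (σ² − δ²)(D₁₁ − D₂₂)`. -/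
theorem bilinear_diag_sub (D : ℝ × ℝ →L[ℝ] ℝ × ℝ →L[ℝ] ℝ)
    (hsym : D (1, 0) (0, 1) = D (0, 1) (1, 0)) (σ δ : ℝ) :
    D (σ, δ) (σ, δ) - D (δ, σ) (δ, σ)
      = (σ ^ 2 - δ ^ 2) * (D (1, 0) (1, 0) - D (0, 1) (0, 1)) := by
  have e1 : ((σ : ℝ), (δ : ℝ)) = σ • ((1 : ℝ), (0 : ℝ)) + δ • ((0 : ℝ), (1 : ℝ)) := by ext <;> simp
  have e2 : ((δ : ℝ), (σ : ℝ)) = δ • ((1 : ℝ), (0 : ℝ)) + σ • ((0 : ℝ), (1 : ℝ)) := by ext <;> simp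
  rw [e1, e2]
  simp only [map_add, map_smul, _root_.add_apply, _root_.smul_apply, smul_eq_mul]
  rw [hsym]
  ring

/-- The `T`-slice of the conformal map and its first two derivatives. -/
theorem hasDerivAt_conformal_curve_fst (hp : ContDiff ℝ 2 p) (hq : ContDiff ℝ 2 q) (X τ : ℝ) :
    HasDerivAt (fun τ : ℝ => ((p (X + τ) - q (X - τ)) / 2, (p (X + τ) + q (X - τ)) / 2))
      (((deriv p (X + τ) + deriv q (X - τ)) / 2, (deriv p (X + τ) - deriv q (X - τ)) / 2)) τ := by
  have hpd : ∀ y, HasDerivAt p (deriv p y) y := fun y => ((hp.differentiable (by norm_num)) y).hasDerivAt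
  have hqd : ∀ y, HasDerivAt q (deriv q y) y := fun y => ((hq.differentiable (by norm_num)) y).hasDerivAt
  have h1 : HasDerivAt (fun τ : ℝ => p (X + τ)) (deriv p (X + τ)) τ := by
    simpa [Function.comp_def] using (hpd (X + τ)).comp τ ((hasDerivAt_id τ).const_add X)
  have h2 : HasDerivAt (fun τ : ℝ => q (X - τ)) (-deriv q (X - τ)) τ := by
    simpa [Function.comp_def] using (hqd (X - τ)).comp τ ((hasDerivAt_id τ).const_sub X)
  refine ((h1.sub h2).div_const 2).prodMk ((h1.add h2).div_const 2) |>.congr_deriv ?_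
  simp only [sub_neg_eq_add, ← sub_eq_add_neg]

/-- The `X`-slice of the conformal map and its first derivative. -/
theorem hasDerivAt_conformal_curve_snd (hp : ContDiff ℝ 2 p) (hq : ContDiff ℝ 2 q) (T y : ℝ) :
    HasDerivAt (fun y : ℝ => ((p (y + T) - q (y - T)) / 2, (p (y + T) + q (y - T)) / 2))
      (((deriv p (y + T) - deriv q (y - T)) / 2, (deriv p (y + T) + deriv q (y - T)) / 2)) y := by
  have hpd : ∀ y, HasDerivAt p (deriv p y) y := fun y => ((hp.differentiable (by norm_num)) y).hasDerivAt
  have hqd : ∀ y, HasDerivAt q (deriv q y) y := fun y => ((hq.differentiable (by norm_num)) y).hasDerivAt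
  have h1 : HasDerivAt (fun y : ℝ => p (y + T)) (deriv p (y + T)) y := by
    simpa [Function.comp_def] using (hpd (y + T)).comp y ((hasDerivAt_id y).add_const T)
  have h2 : HasDerivAt (fun y : ℝ => q (y - T)) (deriv q (y - T)) y := by
    simpa [Function.comp_def] using (hqd (y - T)).comp y ((hasDerivAt_id y).sub_const T)
  exact ((h1.sub h2).div_const 2).prodMk ((h1.add h2).div_const 2)

/-- Derivatives of the velocity fields of the two slices (the accelerations AGREE). -/
theorem hasDerivAt_conformal_velocity_fst (hp : ContDiff ℝ 2 p) (hq : ContDiff ℝ 2 q) (X τ : ℝ) :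
    HasDerivAt (fun τ : ℝ => ((deriv p (X + τ) + deriv q (X - τ)) / 2,
        (deriv p (X + τ) - deriv q (X - τ)) / 2))
      (((deriv (deriv p) (X + τ) - deriv (deriv q) (X - τ)) / 2,
        (deriv (deriv p) (X + τ) + deriv (deriv q) (X - τ)) / 2)) τ := by
  have hp' : ContDiff ℝ 1 (deriv p) := (contDiff_succ_iff_deriv.mp hp).2.2
  have hq' : ContDiff ℝ 1 (deriv q) := (contDiff_succ_iff_deriv.mp hq).2.2
  have hpd : ∀ y, HasDerivAt (deriv p) (deriv (deriv p) y) y := fun y =>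
    ((hp'.differentiable (by norm_num)) y).hasDerivAt
  have hqd : ∀ y, HasDerivAt (deriv q) (deriv (deriv q) y) y := fun y =>
    ((hq'.differentiable (by norm_num)) y).hasDerivAt
  have h1 : HasDerivAt (fun τ : ℝ => deriv p (X + τ)) (deriv (deriv p) (X + τ)) τ := by
    simpa [Function.comp_def] using (hpd (X + τ)).comp τ ((hasDerivAt_id τ).const_add X)
  have h2 : HasDerivAt (fun τ : ℝ => deriv q (X - τ)) (-deriv (deriv q) (X - τ)) τ := by
    simpa [Function.comp_def] using (hqd (X - τ)).comp τ ((hasDerivAt_id τ).const_sub X)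
  refine ((h1.add h2).div_const 2).prodMk ((h1.sub h2).div_const 2) |>.congr_deriv ?_
  simp only [sub_neg_eq_add, ← sub_eq_add_neg]

/-- Same for the `X`-slice. -/
theorem hasDerivAt_conformal_velocity_snd (hp : ContDiff ℝ 2 p) (hq : ContDiff ℝ 2 q) (T y : ℝ) :
    HasDerivAt (fun y : ℝ => ((deriv p (y + T) - deriv q (y - T)) / 2,
        (deriv p (y + T) + deriv q (y - T)) / 2))
      (((deriv (deriv p) (y + T) - deriv (deriv q) (y - T)) / 2,
        (deriv (deriv p) (y + T) + deriv (deriv q) (y - T)) / 2)) y := by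
  have hp' : ContDiff ℝ 1 (deriv p) := (contDiff_succ_iff_deriv.mp hp).2.2
  have hq' : ContDiff ℝ 1 (deriv q) := (contDiff_succ_iff_deriv.mp hq).2.2
  have hpd : ∀ y, HasDerivAt (deriv p) (deriv (deriv p) y) y := fun y =>
    ((hp'.differentiable (by norm_num)) y).hasDerivAt
  have hqd : ∀ y, HasDerivAt (deriv q) (deriv (deriv q) y) y := fun y =>
    ((hq'.differentiable (by norm_num)) y).hasDerivAt
  have h1 : HasDerivAt (fun y : ℝ => deriv p (y + T)) (deriv (deriv p) (y + T)) y := by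
    simpa [Function.comp_def] using (hpd (y + T)).comp y ((hasDerivAt_id y).add_const T)
  have h2 : HasDerivAt (fun y : ℝ => deriv q (y - T)) (deriv (deriv q) (y - T)) y := by
    simpa [Function.comp_def] using (hqd (y - T)).comp y ((hasDerivAt_id y).sub_const T)
  exact ((h1.sub h2).div_const 2).prodMk ((h1.add h2).div_const 2)

/-- The conformal composite `u = Ψ ∘ S` is `C²` (resp. `C³`) when `Ψ` and `p, q` are. -/
theorem contDiff_conformal {n : ℕ} (hΨ : ContDiff ℝ n Ψ) (hp : ContDiff ℝ n p) (hq : ContDiff ℝ n q) :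
    ContDiff ℝ n (fun z : ℝ × ℝ => Ψ ((p (z.2 + z.1) - q (z.2 - z.1)) / 2,
      (p (z.2 + z.1) + q (z.2 - z.1)) / 2)) := by
  have hA : ContDiff ℝ n fun z : ℝ × ℝ => p (z.2 + z.1) := hp.comp (contDiff_snd.add contDiff_fst)
  have hB : ContDiff ℝ n fun z : ℝ × ℝ => q (z.2 - z.1) := hq.comp (contDiff_snd.sub contDiff_fst)
  exact hΨ.comp (((hA.sub hB).div_const 2).prodMk ((hA.add hB).div_const 2))

/-- **First partials of the conformal composite.** -/
theorem fderiv_conformal (hΨ : ContDiff ℝ 2 Ψ) (hp : ContDiff ℝ 2 p) (hq : ContDiff ℝ 2 q)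
    (T X : ℝ) :
    fderiv ℝ (fun z : ℝ × ℝ => Ψ ((p (z.2 + z.1) - q (z.2 - z.1)) / 2,
        (p (z.2 + z.1) + q (z.2 - z.1)) / 2)) (T, X) (1, 0)
      = fderiv ℝ Ψ ((p (X + T) - q (X - T)) / 2, (p (X + T) + q (X - T)) / 2)
          ((deriv p (X + T) + deriv q (X - T)) / 2, (deriv p (X + T) - deriv q (X - T)) / 2) ∧
    fderiv ℝ (fun z : ℝ × ℝ => Ψ ((p (z.2 + z.1) - q (z.2 - z.1)) / 2,
        (p (z.2 + z.1) + q (z.2 - z.1)) / 2)) (T, X) (0, 1)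
      = fderiv ℝ Ψ ((p (X + T) - q (X - T)) / 2, (p (X + T) + q (X - T)) / 2)
          ((deriv p (X + T) - deriv q (X - T)) / 2, (deriv p (X + T) + deriv q (X - T)) / 2) := by
  have hu := contDiff_conformal (n := 2) hΨ hp hq
  have hud := differentiable_of_contDiff_two hu
  have hd := differentiable_of_contDiff_two hΨ
  constructor
  · have h1 := hasDerivAt_slice_fst hud T X
    have h2 : HasDerivAt (fun τ : ℝ => Ψ ((p (X + τ) - q (X - τ)) / 2, (p (X + τ) + q (X - τ)) / 2))
        (fderiv ℝ Ψ ((p (X + T) - q (X - T)) / 2, (p (X + T) + q (X - T)) / 2)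
          ((deriv p (X + T) + deriv q (X - T)) / 2, (deriv p (X + T) - deriv q (X - T)) / 2)) T :=
      hasDerivAt_comp_curve hd (hasDerivAt_conformal_curve_fst hp hq X T)
    exact h1.unique h2
  · have h1 := hasDerivAt_slice_snd hud T X
    have h2 : HasDerivAt (fun y : ℝ => Ψ ((p (y + T) - q (y - T)) / 2, (p (y + T) + q (y - T)) / 2))
        (fderiv ℝ Ψ ((p (X + T) - q (X - T)) / 2, (p (X + T) + q (X - T)) / 2)
          ((deriv p (X + T) - deriv q (X - T)) / 2, (deriv p (X + T) + deriv q (X - T)) / 2)) X :=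
      hasDerivAt_comp_curve hd (hasDerivAt_conformal_curve_snd hp hq T X)
    exact h1.unique h2

/-- **The conformal chain rule for the `1+1` wave operator.**  For `Ψ ∈ C²(ℝ²)`, `p, q ∈ C²(ℝ)`
and `u(T, X) = Ψ((p(X+T) − q(X−T))/2, (p(X+T) + q(X−T))/2)`:
`u_TT − u_XX = (Ψ_tt − Ψ_xx)(S(T,X)) · p′(X+T) q′(X−T)` (all second partials as
`fderiv (fderiv ·)`). [folklore] -/
theorem wave_conformal (hΨ : ContDiff ℝ 2 Ψ) (hp : ContDiff ℝ 2 p) (hq : ContDiff ℝ 2 q)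
    (T X : ℝ) :
    fderiv ℝ (fderiv ℝ (fun z : ℝ × ℝ => Ψ ((p (z.2 + z.1) - q (z.2 - z.1)) / 2,
        (p (z.2 + z.1) + q (z.2 - z.1)) / 2))) (T, X) (1, 0) (1, 0)
      - fderiv ℝ (fderiv ℝ (fun z : ℝ × ℝ => Ψ ((p (z.2 + z.1) - q (z.2 - z.1)) / 2,
        (p (z.2 + z.1) + q (z.2 - z.1)) / 2))) (T, X) (0, 1) (0, 1)
      = (fderiv ℝ (fderiv ℝ Ψ) ((p (X + T) - q (X - T)) / 2, (p (X + T) + q (X - T)) / 2) (1, 0) (1, 0)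
          - fderiv ℝ (fderiv ℝ Ψ) ((p (X + T) - q (X - T)) / 2, (p (X + T) + q (X - T)) / 2) (0, 1) (0, 1))
        * (deriv p (X + T) * deriv q (X - T)) := by
  have hu := contDiff_conformal (n := 2) hΨ hp hq
  -- curried copy and the bridge to `iteratedDeriv 2` of slices
  have hb1 := iteratedDeriv_two_slice_fst_eq (ψ := fun T X => Ψ ((p (X + T) - q (X - T)) / 2,
      (p (X + T) + q (X - T)) / 2)) (by exact hu) T X
  have hb2 := iteratedDeriv_two_slice_snd_eq (ψ := fun T X => Ψ ((p (X + T) - q (X - T)) / 2,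
      (p (X + T) + q (X - T)) / 2)) (by exact hu) T X
  have hfun : (Function.uncurry fun T X => Ψ ((p (X + T) - q (X - T)) / 2, (p (X + T) + q (X - T)) / 2))
      = fun z : ℝ × ℝ => Ψ ((p (z.2 + z.1) - q (z.2 - z.1)) / 2, (p (z.2 + z.1) + q (z.2 - z.1)) / 2) := by
    funext z; rfl
  rw [hfun] at hb1 hb2
  rw [← hb1, ← hb2]
  -- the two slices along curves
  rw [iteratedDeriv_two_comp_curve hΨ (fun τ => hasDerivAt_conformal_curve_fst hp hq X τ)
      (hasDerivAt_conformal_velocity_fst hp hq X T),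
    iteratedDeriv_two_comp_curve hΨ (fun y => hasDerivAt_conformal_curve_snd hp hq T y)
      (hasDerivAt_conformal_velocity_snd hp hq T X)]
  have hsym := fderiv_fderiv_symm hΨ ((p (X + T) - q (X - T)) / 2, (p (X + T) + q (X - T)) / 2) (1, 0) (0, 1)
  have hkey := bilinear_diag_sub (fderiv ℝ (fderiv ℝ Ψ) ((p (X + T) - q (X - T)) / 2, (p (X + T) + q (X - T)) / 2))
    hsym ((deriv p (X + T) + deriv q (X - T)) / 2) ((deriv p (X + T) - deriv q (X - T)) / 2)
  rw [add_sub_add_right_eq_sub, hkey]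
  ring

end WaveDefect

end

end Summit.FinalStateConjecture.FinalStateConjecture.Theorems
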